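import Mathlib
import Literature.MathematicalPhysics.QuantumFieldTheory.MagnenRivasseauSeneor1993.MRS93MainStatement
import HarnessLib

/-!
# Magnen–Rivasseau–Sénéor, *Construction of YM₄ with an infrared cutoff* (CMP 155, 1993), §VIII «Slavnov Identities», the FORMAL
# hierarchy (VIII.1)–(VIII.5) AS PRINTED, typed against the statement-layer carrier `MainStatement.AxialTheory` of
# `MRS93MainStatement.lean` (which types the infrared-corrected form (VIII.6) the main statement asserts)

statement-level skeleton of published theorems with citation tags; proofs where landed; nothing here is a claim about the
Yang–Mills mass gap, about continuum YM₄ on T⁴, or about the Clay problem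

**Citation header (reproduction of PUBLISHED work).** J. Magnen, V. Rivasseau, R. Sénéor, *Construction of YM₄ with an infrared
cutoff*, Commun. Math. Phys. **155** (1993) 325–383 [MagnenRivasseauSeneor1993], Sect. VIII pp. 376–378. Loci «p.NNN [PDF nn] tl.k» =
journal page, PDF page (= journal page − 324), text-layer line of the held scan `paper:magnen1993-cmp155-mrs-ym4-infrared-cutoff` (PDF
sha256 fa4ddac3…); displays (VIII.1)–(VIII.6) read on the page images `run/shared/lean/pub/lit-balaban/inprint/lit-balaban-p14/renders-cmp155/`
`p53_full_s6.png`, `p54_full_s6.png`. Cell pub-balaban-gaps (YM blitz, track G3), seat mrs-lit-2; companion record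
`run/shared/lean/pub/pub-balaban-gaps/g3/MRS-AS-PRINTED-estimates.md`. This file IMPORTS seat mrs-lit-1's `MRS93MainStatement.lean` and adds
to its carrier `MainStatement.AxialTheory` (fields `wardLHS`, `E`; predicates `SlavnovPrinted` = (VIII.6)) only the printed FORMAL form
(VIII.5) and its two-point member (VIII.4); nothing of that file is restated.

**Grade of record (lit-balaban YM-INPRINT.md row D1).** Sect. VIII: **SKETCH** (p.378 tl.25 «This achieves our sketch of proof of the
main statement in the introduction.»). (VIII.1)–(VIII.5) are FORMAL identities («Formally we can write this functional as», p.377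
tl.15–16) for the theory WITHOUT the infrared-cutoff correction; the identities MRS assert for their theory are (VIII.6).

**What the paper prints (verbatim; displays from the page images, p.377 [PDF 53]).**
* tl.14–17, (VIII.1): «To derive the exact form of Slavnov identities in the axial gauge, one introduces the generating functional for the
  theory with gauge condition A₀ = 0. Formally we can write this functional as: W(J) = ⟨e^{−F²/4+J·A}δ(A₀)⟩ = ⟨e^{J·A}⟩_ax, (VIII.1)»
* tl.22–25, (VIII.2): «Then in (VIII.1) we perform a change of variables A → A + Dγ; by (infinitesimal) gauge invariance, there is no
  first order dependence in γ, which gives the "Ward" or "Slavnov" equation: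
  ⟨(J^a_m(x)D^{ab}_m(x) − [∂/∂x⁰ A^a_m · D^{ab}_m ∂/∂x⁰]) e^{J·A}⟩_ax = 0. (VIII.2)»
* tl.26–27, (VIII.3): «Integrating by parts and taking into account the fact that A_mD_m = A_m ∂/∂x^m we can rewrite this identity
  simply as: ⟨(J^a_m(x)D^{ab}_m(x) − [∂/∂x^m A^b_m(x)](∂/∂x⁰)²) e^{J·A}⟩_ax = 0. (VIII.3)»
* tl.28–35, (VIII.4): «This identity gives rise to a hierarchy of identities with any number N of external sources. For instance the two
  point function identity is obtained by applying one functional derivative δ/δJ(y) to (VIII.3) and is simply (exchanging the names of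
  x and y); ⟨A^a_m(x)[∂/∂y^n A^b_n(y)](∂/∂y⁰)²⟩_ax = δ_{ab}δ(x − y) ∂/∂y^m. (VIII.4) We should of course understand this identity as applied
  to two test functions of x and y.»
* tl.36–39, (VIII.5): «Similarly we can write e.g. an identity involving N point functions:
  ⟨Σ_{i=1}^{N−1} (Π_{j=1,j≠i}^{N−1} A^{a_j}_{m_j}(x_j)) D^{a_ib}_{m_i}δ(x_i − y) − Π_{j=1}^{N−1} A^{a_j}_{m_j}(x_j)[∂/∂y^n A^b_n(y)](∂/∂y⁰)²⟩_ax = 0.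
  (VIII.5)»
* p.378 [PDF 54] tl.2–12, (VIII.6): «For a theory with a fixed infrared-cutoff of a given type, the linear term in γ for a gauge
  transformation A → A + Dγ receives a contribution from the presence in (VIII.1) of the cutoff. This leads to correction terms in the
  Slavnov identities. For example Eq. (VIII.5) takes the form [same left-hand side] = E_N({x_j}), (VIII.6) where E_N can be computed for
  any given infrared cutoff. If this cutoff is a finite compact box with some kind of boundary conditions, we see that E_N can be
  interpreted as a boundary term, because the gauge invariance is exact inside the box.»

**What is typed / proved here (zero `sorry`; zero closed named facts; predicates on the imported carrier).**
* `SlavnovFormalPrinted T` — (VIII.5) for every N: the left-hand side functional `wardLHS` of the carrier (the SAME expression as in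
  (VIII.6), p.378 tl.5 «Eq. (VIII.5) takes the form») evaluated on the ultraviolet-limit Schwinger functions EQUALS ZERO;
  `SlavnovTwoPointPrinted T` — (VIII.4), its `N = 2` member; `slavnovTwoPoint_of_formal` (hierarchy ⟹ two-point member);
  `slavnovPrinted_iff_formal_of_E_eq_zero` — when the infrared correction vanishes (`E_N ≡ 0`, the formal situation «the gauge invariance
  is exact»), mrs-lit-1's (VIII.6) predicate `SlavnovPrinted` and the formal (VIII.5) coincide; `slavnovFormal_of_printed_on_kernel` — on any
  test datum where `E_N = 0` (e.g. interior data for a box cutoff, p.378 tl.9–12), (VIII.6) gives the formal identity there.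

**Readings (declared).** (i) (VIII.1)–(VIII.3) (the generating functional and the Ward equation before differentiation in the sources)
are quoted, not typed: the carrier holds Schwinger functions, not `W(J)`; (VIII.4)/(VIII.5) are their consequences «applied to test
functions» (tl.34–35), which is what `wardLHS` abstracts. (ii) In the carrier's indexing, `N` counts the `N − 1` field points `x_j` plus `y`
(«an identity involving N point functions»); the two-point identity (VIII.4) is `N = 2`. (iii) The delta-function right side of (VIII.4)
is part of the left-hand-side functional once moved to the left (as (VIII.5) prints it for general N, with `D^{a_ib}δ(x_i − y)`).

**What is NOT claimed.** The formal derivation (change of variables `A → A + Dγ`, integration by parts), any computation of `E_N`, the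
approximate identities with `δ_N(ρ)` (typed by mrs-lit-1 as `ApproximateSlavnovPrinted`, `ErrorTermVanishesPrinted`), perturbative
renormalisability. Nothing here bears on Bałaban's papers.
-/

noncomputable section

namespace Literature.MathematicalPhysics.QuantumFieldTheory.MagnenRivasseauSeneor1993

namespace MainStatement

/-- **(VIII.5)** p.377 [PDF 53] tl.36–39 (page image `p53_full_s6.png`), verbatim: «Similarly we can write e.g. an identity involving N
point functions: ⟨Σ_{i=1}^{N−1}(Π_{j≠i} A^{a_j}_{m_j}(x_j)) D^{a_ib}_{m_i}δ(x_i − y) − Π_{j=1}^{N−1} A^{a_j}_{m_j}(x_j)[∂/∂y^n A^b_n(y)](∂/∂y⁰)²⟩_ax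
= 0. (VIII.5)» — the FORMAL hierarchy (no infrared-cutoff correction): the (VIII.6) left-hand-side functional `wardLHS` of the carrier,
on the ultraviolet-limit Schwinger functions, vanishes for every `N` and all test data. MRS assert (VIII.6) (`SlavnovPrinted`), not this,
for their infrared-cut-off theory. A typed predicate. [cite: MagnenRivasseauSeneor1993, §VIII (VIII.5) p.377] -/
def SlavnovFormalPrinted (T : AxialTheory) : Prop :=
  ∀ (N : ℕ) (x : T.WTest N), T.wardLHSLim N x = 0

/-- **(VIII.4)** p.377 tl.28–35, verbatim: «For instance the two point function identity is obtained by applying one functional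
derivative δ/δJ(y) to (VIII.3) and is simply (exchanging the names of x and y); ⟨A^a_m(x)[∂/∂y^n A^b_n(y)](∂/∂y⁰)²⟩_ax = δ_{ab}δ(x − y)∂/∂y^m.
(VIII.4) We should of course understand this identity as applied to two test functions of x and y.» — the `N = 2` member of the formal
hierarchy (reading (ii)/(iii)). A typed predicate. [cite: MagnenRivasseauSeneor1993, §VIII (VIII.4) p.377] -/
def SlavnovTwoPointPrinted (T : AxialTheory) : Prop :=
  ∀ x : T.WTest 2, T.wardLHSLim 2 x = 0

/-- «This identity gives rise to a hierarchy of identities with any number N of external sources» (p.377 tl.28–29): the hierarchy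
(VIII.5) contains the two-point identity (VIII.4). [cite: MagnenRivasseauSeneor1993, §VIII (VIII.4)–(VIII.5) p.377] -/
theorem slavnovTwoPoint_of_formal {T : AxialTheory} (h : SlavnovFormalPrinted T) : SlavnovTwoPointPrinted T :=
  fun x => h 2 x

/-- p.378 tl.4–5 «For example Eq. (VIII.5) takes the form (VIII.6)»: when the infrared correction `E_N` vanishes identically (the formal
situation of exact gauge invariance), the asserted identities (VIII.6) (`SlavnovPrinted`, mrs-lit-1) ARE the formal hierarchy (VIII.5).
[cite: MagnenRivasseauSeneor1993, §VIII (VIII.5)–(VIII.6) pp.377–378] -/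
theorem slavnovPrinted_iff_formal_of_E_eq_zero {T : AxialTheory} (hE : ∀ (N : ℕ) (x : T.WTest N), T.E N x = 0) :
    SlavnovPrinted T ↔ SlavnovFormalPrinted T := by
  constructor
  · intro h N x
    rw [h N x, hE N x]
  · intro h N x
    rw [h N x, hE N x]

/-- p.378 tl.9–12 «If this cutoff is a finite compact box with some kind of boundary conditions, we see that E_N can be interpreted as a
boundary term, because the gauge invariance is exact inside the box»: on every test datum where `E_N` vanishes, (VIII.6) yields the
formal identity (VIII.5) there. [cite: MagnenRivasseauSeneor1993, §VIII (VIII.6) p.378] -/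
theorem slavnovFormal_of_printed_on_kernel {T : AxialTheory} (h : SlavnovPrinted T) {N : ℕ} {x : T.WTest N}
    (hx : T.E N x = 0) : T.wardLHSLim N x = 0 := by
  rw [h N x, hx]

end MainStatement

end Literature.MathematicalPhysics.QuantumFieldTheory.MagnenRivasseauSeneor1993
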